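import Mathlib
import Summits.ValiantsHypothesis.ValiantsHypothesis.Theorems.LacunarySymmetroidMatrixDescartesDefiniteMomentsZones
import Summits.ValiantsHypothesis.ValiantsHypothesis.Theorems.LacunarySymmetroidMatrixDescartesStubNegRoots

/-!
# `MatrixDescartes` (stmt-ValiantsHypothesis-18050) — the DEFINITE-MOMENTS LAW, zones VIII: the intrinsic hyperbolic
# sector — characterisation, real-zero count, and the crux's inequality at every fat format

HONEST FRAMING.  Cell `pub-symmetroid`, seat `val-sym-mdr-p2` (gen 15); helper file `--supports` the crux
`Theses.LacunarySymmetroid.MatrixDescartes`, NO closure claim.  Corollaries of the lacunary Markus theorem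
(`…DefiniteMomentsZones`): `MatrixDescartes` RESTRICTED TO THE RAYLEIGH-SHARP FORMAT FAMILY, nothing outside it; nothing
on `stub_twoSided`, on `DoorA26`/`DoorA34` off the sector, registers, or `VP ≠ VNP`.

* `rayleighSharp_iff_alternatingScales` — CHARACTERISATION OF THE HYPERBOLIC SECTOR: for `K ≥ 2` real symmetric letters
  at strictly increasing exponents, «every Rayleigh `K`-nomial has `K − 1` positive roots» ⟺ «`F` is definite with
  alternating signs at some `K` positive scales» (⇒ is the lacunary Markus theorem; ⇐ is the intermediate value theorem
  plus Descartes' budget).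
* `rayleighSharp_realRoots_le` — if both `F(X)` and its reflection `F(−X) = ∑ₗ X^{dₗ}((−1)^{dₗ}Sₗ)` are Rayleigh-sharp
  then `det F` has at most `2(K − 1)m + 1` distinct real zeros.
* `natDegree_det_le_of_rayleighSharp` — intrinsic bridge row to the det-real-rooted door (`deg det F ≤ 2m(K−1)+1` when
  `det F` is real-rooted with simple roots).  The crux-currency inequality at fat formats is `…ZonesMDR.rayleighSharp_mdr`.
[folklore] beyond [cite: CameronPsarrakos2019, Thm 3]; axioms `propext`, `Classical.choice`, `Quot.sound`; no definitions.
-/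

-- layout Summits/ValiantsHypothesis/ValiantsHypothesis forces the duplicated namespace component
set_option linter.dupNamespace false

namespace Summit.ValiantsHypothesis.ValiantsHypothesis.Theorems.LacunarySymmetroidMatrixDescartes

open Polynomial Matrix Finset
open scoped BigOperators

namespace DefiniteMoments

section Characterisation

variable {ι : Type} [Fintype ι]

/-- **Alternating scales ⇒ Rayleigh-sharp** (the easy converse of the lacunary Markus theorem): if `F` is definite with
alternating signs at `K` positive scales then every Rayleigh `K`-nomial (`v ≠ 0`) has `K − 1` distinct positive roots
(one in each gap, by the intermediate value theorem). [folklore] -/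
theorem rayleighSharp_of_alternatingScales {K : ℕ} (hK : 2 ≤ K) (d : Fin K → ℕ) (S : Fin K → Matrix ι ι ℝ)
    (a : Fin (K - 1 + 1) → ℝ) (ha : StrictMono a) (ha0 : 0 < a 0) (σ : ℝ)
    (hdef : ∀ (j : Fin (K - 1 + 1)) (v : ι → ℝ), v ≠ 0 →
      0 < σ * (-1) ^ (j : ℕ) * (v ⬝ᵥ ((∑ k, a j ^ d k • S k) *ᵥ v)))
    (v : ι → ℝ) (hv : v ≠ 0) :
    K ≤ ((∑ l, C (v ⬝ᵥ (S l *ᵥ v)) * (X : ℝ[X]) ^ d l).roots.toFinset.filter (fun t => 0 < t)).card + 1 := by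
  classical
  choose z hz1 hz2 hz3 using exists_zero_in_gap d S a ha σ hdef v hv
  have hzinj : Function.Injective z := fun i i' h =>
    gap_eq_of_mem a ha i i' (z i) (hz1 i) (hz2 i) (h ▸ hz1 i') (h ▸ hz2 i')
  have hx₀ : v ⬝ᵥ ((∑ k, a 0 ^ d k • S k) *ᵥ v) ≠ 0 := by
    intro h
    have h0 := hdef 0 v hv
    rw [h, mul_zero] at h0
    exact lt_irrefl 0 h0
  have hP0 := rayleighPoly_ne_zero d S v hx₀
  have hsub : Finset.univ.image z ⊆
      ((∑ l, C (v ⬝ᵥ (S l *ᵥ v)) * (X : ℝ[X]) ^ d l).roots.toFinset.filter (fun t => 0 < t)) := by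
    intro x hx
    obtain ⟨i, -, rfl⟩ := Finset.mem_image.1 hx
    rw [mem_posRoots_iff d S v hP0]
    exact ⟨(ha0.trans_le (ha.monotone (Fin.zero_le _))).trans (hz1 i), hz3 i⟩
  have hcard := Finset.card_le_card hsub
  rw [Finset.card_image_of_injective _ hzinj, Finset.card_univ, Fintype.card_fin] at hcard
  omega

/-- **CHARACTERISATION OF THE HYPERBOLIC SECTOR.**  For `K ≥ 2` real symmetric letters at strictly increasing exponents:
every Rayleigh `K`-nomial (`v ≠ 0`) has `K − 1` distinct positive roots  ⟺  `F` is definite with alternating signs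
(`σ(−1)ʲF(aⱼ) ≻ 0`, `σ = ±1`) at some `K` positive scales `a₀ < ⋯ < a_{K−1}`. [folklore] -/
theorem rayleighSharp_iff_alternatingScales {K : ℕ} (hK : 2 ≤ K) (d : Fin K → ℕ) (hd : StrictMono d)
    (S : Fin K → Matrix ι ι ℝ) (hS : ∀ l, (S l).IsSymm) :
    (∀ v : ι → ℝ, v ≠ 0 →
        K ≤ ((∑ l, C (v ⬝ᵥ (S l *ᵥ v)) * (X : ℝ[X]) ^ d l).roots.toFinset.filter (fun t => 0 < t)).card + 1) ↔
      ∃ (a : Fin (K - 1 + 1) → ℝ) (σ : ℝ), StrictMono a ∧ 0 < a 0 ∧ (σ = 1 ∨ σ = -1) ∧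
        ∀ (j : Fin (K - 1 + 1)) (v : ι → ℝ), v ≠ 0 →
          0 < σ * (-1) ^ (j : ℕ) * (v ⬝ᵥ ((∑ k, a j ^ d k • S k) *ᵥ v)) := by
  constructor
  · exact exists_alternatingScales_of_rayleighSharp hK d hd S hS
  · rintro ⟨a, σ, ha, ha0, -, hdef⟩
    exact rayleighSharp_of_alternatingScales hK d S a ha ha0 σ hdef

end Characterisation

/-! ## Real zeros and the crux's inequality on the sector -/

/-- **Real zeros on the intrinsic hyperbolic sector (both half-lines).**  `K ≥ 2` real symmetric `m × m` letters at
strictly increasing exponents; if `F(X)` and its reflection `F(−X) = ∑ₗ X^{dₗ}((−1)^{dₗ} Sₗ)` are both Rayleigh-sharp,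
then `det F` has at most `(K − 1)m + (K − 1)m + 1` distinct real zeros. [folklore] -/
theorem rayleighSharp_realRoots_le (K m : ℕ) (hK : 2 ≤ K) (d : Fin K → ℕ) (hd : StrictMono d)
    (S : Fin K → Matrix (Fin m) (Fin m) ℝ) (hS : ∀ l, (S l).IsSymm)
    (hsharp : ∀ v : Fin m → ℝ, v ≠ 0 →
      K ≤ ((∑ l, C (v ⬝ᵥ (S l *ᵥ v)) * (X : ℝ[X]) ^ d l).roots.toFinset.filter (fun t => 0 < t)).card + 1)
    (hsharp' : ∀ v : Fin m → ℝ, v ≠ 0 →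
      K ≤ ((∑ l, C (v ⬝ᵥ ((((-1 : ℝ) ^ d l) • S l) *ᵥ v)) * (X : ℝ[X]) ^ d l).roots.toFinset.filter
        (fun t => 0 < t)).card + 1) :
    (Matrix.det (∑ l, ((X : ℝ[X]) ^ d l) • (S l).map C)).roots.toFinset.card
      ≤ (K - 1) * m + (K - 1) * m + 1 := by
  have h1 := card_posRoots_le_of_rayleighSharp hK d hd S hS hsharp
  have h2 := card_posRoots_le_of_rayleighSharp hK d hd (fun l => ((-1 : ℝ) ^ d l) • S l)
    (fun l => (hS l).smul _) hsharp'
  have h3 := stub_negRoots K m d S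
  rw [Fintype.card_fin] at h1 h2
  omega

/-- **Bridge row to the det-real-rooted door, intrinsic form.**  If `F(X)` and `F(−X)` are Rayleigh-sharp and `det F` is
real-rooted with simple roots (`#roots = natDegree`), then `deg det F ≤ 2m(K−1) + 1` — the bound of the linear row
`HyperbolicLinearLaw` (refuted on the det-real-rooted sector as a whole) holds on its intersection with the intrinsic
hyperbolic sector (g14's `natDegree_det_le_linear_on_rayleighHyperbolic` without test points). [folklore] -/
theorem natDegree_det_le_of_rayleighSharp (K m : ℕ) (hK : 2 ≤ K) (d : Fin K → ℕ) (hd : StrictMono d)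
    (S : Fin K → Matrix (Fin m) (Fin m) ℝ) (hS : ∀ l, (S l).IsSymm)
    (hsharp : ∀ v : Fin m → ℝ, v ≠ 0 →
      K ≤ ((∑ l, C (v ⬝ᵥ (S l *ᵥ v)) * (X : ℝ[X]) ^ d l).roots.toFinset.filter (fun t => 0 < t)).card + 1)
    (hsharp' : ∀ v : Fin m → ℝ, v ≠ 0 →
      K ≤ ((∑ l, C (v ⬝ᵥ ((((-1 : ℝ) ^ d l) • S l) *ᵥ v)) * (X : ℝ[X]) ^ d l).roots.toFinset.filter
        (fun t => 0 < t)).card + 1)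
    (hreal : (Matrix.det (∑ l, ((X : ℝ[X]) ^ d l) • (S l).map C)).roots.toFinset.card
      = (Matrix.det (∑ l, ((X : ℝ[X]) ^ d l) • (S l).map C)).natDegree) :
    (Matrix.det (∑ l, ((X : ℝ[X]) ^ d l) • (S l).map C)).natDegree ≤ 2 * m * (K - 1) + 1 := by
  rw [← hreal]
  have h := rayleighSharp_realRoots_le K m hK d hd S hS hsharp hsharp'
  have e : (K - 1) * m + (K - 1) * m + 1 = 2 * m * (K - 1) + 1 := by ring
  omega

end DefiniteMoments

end Summit.ValiantsHypothesis.ValiantsHypothesis.Theorems.LacunarySymmetroidMatrixDescartes
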